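import Summits.AtomisticToContinuum.FouriersLaw.Theses.CageBudgetFekete
import Summits.AtomisticToContinuum.FouriersLaw.Theorems.CageBudgetFeketeHeatVarianceCalculusLaplace
import Summits.AtomisticToContinuum.FouriersLaw.Theorems.CageBudgetFeketeHeatVarianceCalculusCanonicalMajorant
import Literature.MathematicalPhysics.KineticTheory.TransportRegularityOfMixing
import Literature.MathematicalPhysics.KineticTheory.InfiniteChainClusteringTransfer
import Literature.MathematicalPhysics.KineticTheory.InfiniteChainL2Locality
import Literature.MathematicalPhysics.KineticTheory.InfiniteChainTwoPointContinuity
import Literature.MathematicalPhysics.KineticTheory.InfiniteChainGibbsInvariance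
import Literature.MathematicalPhysics.KineticTheory.InfiniteChainShiftInvariantUniqueness
import Literature.MathematicalPhysics.KineticTheory.InfiniteChainCurrentMoments
import Literature.MathematicalPhysics.KineticTheory.InfiniteChainCorrelationContinuity
import Literature.MathematicalPhysics.KineticTheory.InfiniteChainCurrentPositiveType
import Literature.MathematicalPhysics.KineticTheory.InfiniteChainSuperstableOrbits
import HarnessLib

/-!
# `CageBudgetFekete.HeatVarianceCalculus` — PROVED (item stmt-AtomisticToContinuum-15772, route CageBudgetFekete)

Sorry-free proof of the route item
`Summit.AtomisticToContinuum.FouriersLaw.Theses.CageBudgetFekete.HeatVarianceCalculus`: the infinite-volume calculus of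
the heat variance for EVERY guarded pair `(μ_T, D)` of the pinned anharmonic chain `pinnedChain ω₂ lam β γ`
(`ω₂, lam, β > 0`, `T > 0`): (a) absolutely convergent summed current correlations at every `t`; (b) continuity of
`t ↦ C_T(t)`; (c) `V_T(τ) = 2∫_{(0,τ]}(τ-s)C_T(s)ds ≥ 0` for `τ ≥ 0`; (d) Laplace integrability and
`∫₀^∞e^{-νt}C_T = (ν²/2)∫₀^∞e^{-νt}V_T` for every `ν > 0`.

Line `canonical-rigidity` (`Cruxes/HeatVarianceCalculus/Lines/canonical_rigidity.lean`, crux strategist 2026-08-17), its two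
registered stubs landed as `--supports` files:
`stub_canonicalClusteringMajorant` (`Theorems/CageBudgetFeketeHeatVarianceCalculusCanonicalMajorant.lean`) and
`stub_laplaceHeatVariance` (`Theorems/CageBudgetFeketeHeatVarianceCalculusLaplace.lean`).

## Proof architecture

* **Dynamics rigidity** (`flow_ae_eq_canonical`): every dynamics `D` preserving a shift-invariant DLR state `μ_T`
  coincides `μ_T`-a.e., AT ALL TIMES, with the canonical Buttà–Marchioro dynamics `D♭` of
  `OscillatorChain.exists_bmDynamics` (carrier `bmGood`): superstability of the shift-invariant state
  (`hasSuperstabilityEstimate_of_isShiftInvariant_pinnedChain`) + sup-in-time BM (2.6)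
  (`ae_forall_flow_mem_bmGood_pinnedChain`) + the uniqueness field of `D♭`.
* **Composition** (`heatVarianceCalculus_proof`): rigidity ⇒ every correlation term of `D` equals that of `D♭`;
  (a) absolute convergence from the canonical majorant (stub 1) at the window `τ = |t|`; (b) continuity of
  `C_T = Σ_x c_x` by the Weierstrass M-test on open windows with `continuous_integral_bondCurrentZ_mul_flow_pinnedChain`;
  (c) `V_T ≥ 0` and `|C_T| ≤ C_T(0)` from `currentCorrelation_positiveType_of_carrier_subset_bmGood` for `D♭`;
  (d) the Laplace stub with `M = C_T(0)`.

The momentum-reversal invariance and the a.e. shift-covariance hypotheses of the item are not used (rigidity makes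
them idle), as recorded by the refuter's vetting (evidence VETTING.md) and the strategist's census.

[cite: ButtaMarchioro2016, §2 Thm 2.1, eq. (2.6) and §3] [cite: Georgii2011, Thm 10.25 and §11.1]
[cite: LanfordLebowitzLieb1977, §4] [cite: BonettoLebowitzReyBellet2000, §7 eq. (37)] [cite: Helfand1960]
-/

noncomputable section

namespace Summit.AtomisticToContinuum.FouriersLaw.Theorems.HeatVarianceCalculus.CanonicalRigidity

open MeasureTheory ProbabilityTheory Filter Set Function
open scoped Topology BigOperators
open Literature.MathematicalPhysics.KineticTheory.HeatConduction

/-- **Dynamics rigidity.** For the pinned chain (`ω₂, lam, β > 0`), a shift-invariant DLR state `μ`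
at `T > 0`, ANY dynamics `D` preserving `μ` and ANY dynamics `D'` whose carrier is BM's good set:
`μ`-a.e. orbit of `D` is the orbit of `D'`, simultaneously for all times. (Superstability of the
shift-invariant state; sup-in-time BM (2.6) `ae_forall_flow_mem_bmGood_pinnedChain`; the uniqueness
field of `D'`.) No shift covariance and no momentum-reversal invariance is used. [folklore] -/
theorem flow_ae_eq_canonical {ω₂ lam β : ℝ} (γ : ℝ) (hω : 0 < ω₂) (hl : 0 < lam) (hβ : 0 < β)
    {T : ℝ} (hT : 0 < T) {μ : Measure ChainConfig}
    (hG : (pinnedChain ω₂ lam β γ).IsChainGibbsMeasure T μ) (hSI : IsShiftInvariant μ)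
    (D D' : InfiniteChainDynamics (pinnedChain ω₂ lam β γ)) (hP : D.PreservesMeasure μ)
    (hcar : D'.carrier = (pinnedChain ω₂ lam β γ).bmGood) :
    ∀ᵐ σ ∂μ, ∀ t : ℝ, D.flow t σ = D'.flow t σ := by
  have hss : (pinnedChain ω₂ lam β γ).HasSuperstabilityEstimate μ :=
    OscillatorChain.hasSuperstabilityEstimate_of_isShiftInvariant_pinnedChain γ hω hl.le hβ.le hT hG hSI
  have hgood := OscillatorChain.ae_forall_flow_mem_bmGood_pinnedChain γ hω.le hl hβ hss D hP
  filter_upwards [hP.1, hgood] with σ hσ hσgood t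
  have h := D'.unique (fun u => D.flow u σ) (fun u => by rw [hcar]; exact hσgood u)
    (D.isSolution σ hσ) t
  simpa only [D.flow_zero σ hσ] using h

/-- **The route item `CageBudgetFekete.HeatVarianceCalculus`, proved** (closes stmt-AtomisticToContinuum-15772).
Rigidity (`flow_ae_eq_canonical`) makes every correlation term of the guarded `D` equal to the corresponding term of
the canonical `D♭` of `exists_bmDynamics`; (a) absolute convergence from the canonical majorant
(`stub_canonicalClusteringMajorant`) at the window `τ = |t|` and the in-tree integrability of the terms; (b) continuity
of `C_T = Σ_x c_x` by the Weierstrass M-test on open windows, each `c_x` continuous in tree; (c) `V_T ≥ 0` and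
`|C_T| ≤ C_T(0)` from the in-tree positive type of `D♭` (carrier `⊆ bmGood`); (d) the Laplace clauses from
`stub_laplaceHeatVariance` with `M = C_T(0)`.
[cite: ButtaMarchioro2016, §2 Thm 2.1, eq. (2.6) and §3] [cite: Helfand1960] -/
theorem heatVarianceCalculus_proof :
    Summit.AtomisticToContinuum.FouriersLaw.Theses.CageBudgetFekete.HeatVarianceCalculus := by
  have h1 := stub_canonicalClusteringMajorant
  have h3 := stub_laplaceHeatVariance
  intro ω₂ lam β γ hω hl hβ T hT μ hG hSI hRefl D hP _
  -- superstability of the shift-invariant Gibbs state and the polynomial data of the chain (in tree)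
  have hss : (pinnedChain ω₂ lam β γ).HasSuperstabilityEstimate μ :=
    OscillatorChain.hasSuperstabilityEstimate_of_isShiftInvariant_pinnedChain γ hω hl.le hβ.le hT hG hSI
  have hU0 : ∀ q : ℝ, 0 ≤ (pinnedChain ω₂ lam β γ).U q :=
    OscillatorChain.pinnedChain_U_nonneg β γ hω.le hl.le
  have hUm : Measurable (pinnedChain ω₂ lam β γ).U := OscillatorChain.measurable_pinnedChain_U ω₂ lam β γ
  have hU2 : OscillatorChain.IsEvenPolyOfDegree (pinnedChain ω₂ lam β γ).U 2 :=
    OscillatorChain.pinnedChain_isEvenPolyOfDegree_U β γ hω.le hl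
  have hV2 : OscillatorChain.IsEvenPolyOfDegree (pinnedChain ω₂ lam β γ).V 2 :=
    OscillatorChain.pinnedChain_isEvenPolyOfDegree_V ω₂ lam γ hβ
  -- the canonical Buttà–Marchioro dynamics `D♭` (carrier `bmGood`, measurable flow, identity off `bmGood`)
  obtain ⟨D', hcar, hmeas, hid, -, -, -, hpresAll⟩ :=
    OscillatorChain.exists_bmDynamics (P := pinnedChain ω₂ lam β γ) one_le_two one_le_two hU2 hV2
  have hP' : D'.PreservesMeasure μ := hpresAll T μ hG hss
  -- RIGIDITY: the guarded `D` is `D♭` a.e., at all times; hence every correlation term agrees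
  have hrig := flow_ae_eq_canonical γ hω hl hβ hT hG hSI D D' hP hcar
  have hterm : ∀ (t : ℝ) (x : ℤ),
      ∫ σ, (pinnedChain ω₂ lam β γ).bondCurrentZ σ 0 *
          (pinnedChain ω₂ lam β γ).bondCurrentZ (D.flow t σ) x ∂μ =
        ∫ σ, (pinnedChain ω₂ lam β γ).bondCurrentZ σ 0 *
          (pinnedChain ω₂ lam β γ).bondCurrentZ (D'.flow t σ) x ∂μ := fun t x => by
    refine integral_congr_ae ?_
    filter_upwards [hrig] with σ hσ
    rw [hσ t]
  have hCC' : ∀ t : ℝ, D.currentCorrelation μ t = D'.currentCorrelation μ t := fun t => by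
    unfold InfiniteChainDynamics.currentCorrelation
    exact tsum_congr fun x => hterm t x
  have hCfun : (fun t : ℝ => D.currentCorrelation μ t) = fun t : ℝ => D'.currentCorrelation μ t :=
    funext hCC'
  -- the terms: integrable integrands (both dynamics) and continuity in `t` (canonical dynamics), in tree
  have hint : ∀ (t : ℝ) (x : ℤ), Integrable (fun σ =>
      (pinnedChain ω₂ lam β γ).bondCurrentZ σ 0 *
        (pinnedChain ω₂ lam β γ).bondCurrentZ (D.flow t σ) x) μ := fun t x =>
    hss.integrable_bondCurrentZ_mul_comp one_le_two hU0 hUm hV2 (hP.2 t) x 0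
  have hint' : ∀ (t : ℝ) (x : ℤ), Integrable (fun σ =>
      (pinnedChain ω₂ lam β γ).bondCurrentZ σ 0 *
        (pinnedChain ω₂ lam β γ).bondCurrentZ (D'.flow t σ) x) μ := fun t x =>
    hss.integrable_bondCurrentZ_mul_comp one_le_two hU0 hUm hV2 (hP'.2 t) x 0
  have hcont' : ∀ x : ℤ, Continuous fun t : ℝ =>
      ∫ σ, (pinnedChain ω₂ lam β γ).bondCurrentZ σ 0 *
        (pinnedChain ω₂ lam β γ).bondCurrentZ (D'.flow t σ) x ∂μ := fun x =>
    InfiniteChainDynamics.continuous_integral_bondCurrentZ_mul_flow_pinnedChain γ hω.le hl.le hβ hss D' hP' x 0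
  -- Stub 1 for the canonical pair
  have h1' := h1 ω₂ lam β γ hω hl hβ T hT μ hG hSI hRefl D' hcar hmeas hid
  -- (a) absolute convergence at every time, for `D♭` and (by rigidity) for `D`
  have hAC' : ∀ t : ℝ, D'.HasAbsConvergentCorrelation μ t := fun t => by
    obtain ⟨m, hm, hb⟩ := h1' |t|
    exact ⟨fun x => hint' t x,
      Summable.of_nonneg_of_le (fun x => abs_nonneg _) (fun x => hb t le_rfl x) hm⟩
  have hAC : ∀ t : ℝ, D.HasAbsConvergentCorrelation μ t := fun t => by
    obtain ⟨m, hm, hb⟩ := h1' |t|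
    refine ⟨fun x => hint t x, Summable.of_nonneg_of_le (fun x => abs_nonneg _) (fun x => ?_) hm⟩
    rw [hterm t x]
    exact hb t le_rfl x
  -- (b) continuity of `C_T` (for `D♭`, by the Weierstrass M-test on open windows; `C_T` of `D` is the same function)
  have hC' : Continuous fun t : ℝ => D'.currentCorrelation μ t := by
    refine continuous_iff_continuousAt.2 fun t₀ => ?_
    obtain ⟨m, hm, hb⟩ := h1' (|t₀| + 1)
    have hon : ContinuousOn (fun t : ℝ => ∑' x : ℤ,
        ∫ σ, (pinnedChain ω₂ lam β γ).bondCurrentZ σ 0 *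
          (pinnedChain ω₂ lam β γ).bondCurrentZ (D'.flow t σ) x ∂μ)
        (Set.Ioo (-(|t₀| + 1)) (|t₀| + 1)) :=
      continuousOn_tsum (fun x => (hcont' x).continuousOn) hm fun x t ht => by
        rw [Real.norm_eq_abs]
        exact hb t (abs_le.2 ⟨ht.1.le, ht.2.le⟩) x
    exact hon.continuousAt
      (Ioo_mem_nhds (by linarith [neg_abs_le t₀]) (by linarith [le_abs_self t₀]))
  have hC : Continuous fun t : ℝ => D.currentCorrelation μ t := by rw [hCfun]; exact hC'
  -- (c) positive type of the canonical autocorrelation (carrier `= bmGood`), in tree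
  obtain ⟨-, hbd', hpos'⟩ :=
    D'.currentCorrelation_positiveType_of_carrier_subset_bmGood one_le_two one_le_two hU2 hV2 hss hSI
      hcar.le hP' hAC'
  have hbd : ∀ t : ℝ, |D.currentCorrelation μ t| ≤ D.currentCorrelation μ 0 := fun t => by
    rw [hCC' t, hCC' 0]; exact hbd' t
  refine ⟨hAC, hC, fun V hV => ⟨fun τ hτ => ?_, fun ν hν => ?_⟩⟩
  · subst hV
    dsimp only
    refine mul_nonneg zero_le_two ?_
    have e : (fun s : ℝ => (τ - s) * D.currentCorrelation μ s) =
        fun s : ℝ => (τ - s) * D'.currentCorrelation μ s := funext fun s => by rw [hCC' s]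
    rw [e]
    exact hpos' τ hτ
  · -- (d) the Laplace clauses from Stub 2 with `M = C_T(0)`
    exact h3 (fun t : ℝ => D.currentCorrelation μ t) hC ⟨D.currentCorrelation μ 0, hbd⟩ V hV ν hν

end Summit.AtomisticToContinuum.FouriersLaw.Theorems.HeatVarianceCalculus.CanonicalRigidity

end
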